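import Literature.NumberTheory.ConnesConsani2021.FiniteRankApproximant
import Mathlib.Analysis.Fourier.AddCircle
import HarnessLib

/-!
# Connes–Consani 2021, §6.4–6.6: "the vectors `ξ_n` form an orthonormal basis of `𝓗`" —
# completeness of `(ξ_n)_{n∈ℤ}` in `L²(I)`, `Σ_{n∈ℤ} e_n = 1`, and the Parseval steps of the
# proofs of Lemma 6.4 and Lemma 6.6 — PROVED

A. Connes, C. Consani, *Weil positivity and trace formula, the archimedean place*, Selecta Math.
(N.S.) 27 (2021), Paper No. 77 = arXiv:2006.13771 [bib: `ConnesConsani2021`]; §6.4 (= arXiv p. 24: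
displays (xialpha), (opT)), proof of Lemma 6.4 (= arXiv Lemma 37, p. 25, last sentence), proof of
Lemma 6.6 (= arXiv Lemma 39, p. 25, first two displays).

**What is printed.**  §6.4: "we consider the Hilbert space `𝓗 := L²([−½log 2, ½log 2], dx)`.  For
`α ∈ ℝ` we let (xialpha) `ξ_α(x) := (log 2)^{−1/2} exp(2πiαx/log 2)` … and `e_α = |ξ_α⟩⟨ξ_α|` be the
associated orthogonal projection."  Lemma 6.3: "… the finite rank operator (opT)
`T = λ Σ_{n∈ℤ} (e_n − d(|n|) e_{α_n})`.  Here, we set `α_{−n} = −α_n ∀n` and `d(0) = 0`; while for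
`n > m`, we set `α_n = n` and `d(n) = 1` so that all the terms in the above sum for `|n| > m`
vanish."  Proof of Lemma 6.4, last sentence: "The orthogonality of `ψ` to all the vectors `ξ_{α_n}`
shows using (opT) that `Tψ = λ Σ e_n ψ = λψ`, since the vectors `ξ_n` form an orthonormal basis
of `𝓗`."  Proof of Lemma 6.6 (`P(n)` "the orthogonal projection on the linear span of the vectors
`ξ_j` for `|j| < n`"): "The components of the vector `ξ_α` in the basis `ξ_m` are given as follows
`(ξ_α)_k = (log 2)⁻¹ ∫_{−log 2/2}^{log 2/2} exp(2πi(α−k)x/log 2) dx = sin(π(α−k))/(π(α−k))`.  One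
then uses the identity, for `a < n`, `Σ_{k=n}^{∞} (sin(π(a−k))/(π(a−k)))² = …`.  Similarly for
`−n < a` one has `Σ_{k=−∞}^{−n} (sin(π(a−k))/(π(a−k)))² = …`" — i.e. the Parseval expansion
`‖ξ_α − P(n)ξ_α‖² = Σ_{|k| ≥ n} |(ξ_α)_k|²`.

**What is PROVED here**, for any interval `I = [a, b]`, `L = b − a > 0` (CC: `L = log 2`), in the
vocabulary of `FiniteRankApproximant.lean` (`expVector a b α = ξ_α`, `expProj a b α = e_α`,
`opT` = the operator of (opT) written out):

* `⟨ξ_n|ξ⟩ = √L · ĉ_n(ξ)` where `ĉ_n` is Mathlib's `fourierCoeffOn` on `(a, b]`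
  (`inner_expVector_intCast_eq_fourierCoeffOn`), hence **Parseval** `Σ_{n∈ℤ} |⟨ξ_n|ξ⟩|² = ‖ξ‖²`
  (`hasSum_sq_norm_inner_expVector`, from Mathlib's `hasSum_sq_fourierCoeffOn`);
* `(ξ_n)_{n∈ℤ}` is orthonormal on any interval of length `L` (`orthonormal_expVector_intCast`;
  the symmetric case is `orthonormal_expVector_int` of `FiniteRankApproximant.lean`) and
  **complete**: a vector orthogonal to every `ξ_n` vanishes (`eq_zero_of_forall_inner_expVector`),
  `(span{ξ_n})^⊥ = 0` (`orthogonal_span_expVector_eq_bot`), the closed span is `𝓗`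
  (`topologicalClosure_span_expVector`), and `(ξ_n)` is (the underlying family of) a Hilbert basis
  of `𝓗 = L²(I)` (`exists_hilbertBasis_expVector`) — "the vectors `ξ_n` form an orthonormal basis
  of `𝓗`";
* **`Σ_{n∈ℤ} e_n = 1`** strongly: `Σ_n e_n ψ = ψ` (`hasSum_expProj`) and weakly
  `Σ_n ⟨η|e_n ξ⟩ = ⟨η|ξ⟩` (`hasSum_inner_expProj`);
* the **last sentence of the proof of Lemma 6.4 in its literal form**: if `ψ ⊥ ξ_{±α_n}` for all
  `n ≥ 1`, with CC's convention `α_n = n` for `n > m`, then `Tψ = λψ`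
  (`opT_apply_of_orthogonal_of_convention`; the finite form with the hypothesis
  `(e_0 + Σ_{n=1}^{m}(e_n + e_{−n}))ψ = ψ` is `opT_apply_of_orthogonal` of `FiniteRankApproximant.lean`,
  and that hypothesis is DERIVED here from completeness: `expProj_partial_sum_eq_self`);
* the **Parseval step of the proof of Lemma 6.6** on CC's interval `[−L/2, L/2]`: with
  `P(n) = Σ_{|j|<n} e_j`, `‖ξ_α − P(n)ξ_α‖² = Σ_{|k| ≥ n} (sin(π(α−k))/(π(α−k)))²`
  (`hasSum_sinc_sq_norm_sub_proj`; the components `(ξ_α)_k = sinc(π(α−k))` are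
  `inner_expVector_expVector_symm` of `FiniteRankApproximant.lean`).

Not typed here: the closed form of these tails through `(log Γ)^{(2)}` (the trigamma series
`(log Γ)''(x) = Σ_{k≥0}(x+k)^{−2}` is not in Mathlib), the Paley–Wiener construction of `ψ`
(Lemma 6.4, first part), Lemma 6.8.  No RH claim; no named fact is introduced; no new mathematics
(cell `pub-rhdoor`, `HOME/lit/CC2021-RIGOUR-MAP.md` §1 items 7b/8).
-/

noncomputable section

open MeasureTheory Set Complex Filter Submodule
open scoped ComplexConjugate InnerProductSpace Real

namespace Literature.NumberTheory.ConnesConsani2021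

variable {a b : ℝ}

/-! ## `⟨ξ_n|ξ⟩ = √L · ĉ_n(ξ)` and Parseval -/

/-- `(√L)⁻¹ = √L · (1/L)`. [folklore] -/
private theorem inv_sqrt_eq_sqrt_mul {L : ℝ} : (Real.sqrt L)⁻¹ = Real.sqrt L * (1 / L) := by
  rw [inv_eq_one_div, ← Real.sqrt_div_self', div_eq_mul_one_div]

/-- **`⟨ξ_n|ξ⟩ = √L · ĉ_n(ξ)`**: the coefficient of `ξ ∈ 𝓗 = L²(I)` against CC's `ξ_n`, `n ∈ ℤ`
("`⟨ξ_{α_n}|ψ⟩ = (log 2)^{−1/2} ∫_I ψ(x) exp(−2πiα_n x/log 2) dx`", proof of Lemma 6.4) is `√L`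
times Mathlib's `n`-th Fourier coefficient `fourierCoeffOn` of `ξ` on `(a, b]`
(`= L⁻¹ ∫_a^b exp(−2πinx/L) ξ(x) dx`). [cite: ConnesConsani2021, Lemma 6.4 §6.5 p. 25 (proof)] -/
theorem inner_expVector_intCast_eq_fourierCoeffOn (hab : a < b) (n : ℤ)
    (ξ : Lp ℂ 2 (volume.restrict (Icc a b))) :
    ⟪expVector a b n, ξ⟫_ℂ = ((Real.sqrt (b - a) : ℝ) : ℂ) * fourierCoeffOn hab (ξ : ℝ → ℂ) n := by
  rw [inner_expVector_left, fourierCoeffOn_eq_integral, intervalIntegral.integral_of_le hab.le,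
    ← integral_Icc_eq_integral_Ioc, Complex.real_smul, ← mul_assoc, ← Complex.ofReal_mul,
    ← inv_sqrt_eq_sqrt_mul, ← integral_const_mul]
  refine integral_congr_ae (Eventually.of_forall fun x ↦ ?_)
  dsimp only
  rw [conj_expFun, smul_eq_mul, ← mul_assoc]
  congr 1
  rw [expFun, fourier_coe_apply]
  congr 1
  congr 1
  push_cast
  ring

/-- `‖ξ‖² = ∫_I |ξ(x)|² dx` for `ξ ∈ L²(I)`. [folklore] -/
private theorem norm_sq_eq_integral (ξ : Lp ℂ 2 (volume.restrict (Icc a b))) :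
    ‖ξ‖ ^ 2 = ∫ x in Icc a b, ‖(ξ : ℝ → ℂ) x‖ ^ 2 := by
  have H := congr_arg RCLike.re (L2.inner_def (𝕜 := ℂ) ξ ξ)
  rw [← integral_re (L2.integrable_inner (𝕜 := ℂ) ξ ξ)] at H
  simp only [← norm_sq_eq_re_inner] at H
  exact H

/-- **Parseval in the basis `(ξ_n)_{n∈ℤ}`**: `Σ_{n∈ℤ} |⟨ξ_n|ξ⟩|² = ‖ξ‖²` for every `ξ ∈ 𝓗 = L²(I)`
("the vectors `ξ_n` form an orthonormal basis of `𝓗`", proof of Lemma 6.4; "The components of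
the vector `ξ_α` in the basis `ξ_m` …", proof of Lemma 6.6) — from Mathlib's Parseval identity
`hasSum_sq_fourierCoeffOn` on `(a, b]`. [cite: ConnesConsani2021, Lemma 6.4 §6.5 p. 25 (proof)] -/
theorem hasSum_sq_norm_inner_expVector (hab : a < b) (ξ : Lp ℂ 2 (volume.restrict (Icc a b))) :
    HasSum (fun n : ℤ ↦ ‖⟪expVector a b n, ξ⟫_ℂ‖ ^ 2) (‖ξ‖ ^ 2) := by
  have hba : 0 < b - a := sub_pos.2 hab
  have hL2 : MemLp (ξ : ℝ → ℂ) 2 (volume.restrict (Ioc a b)) :=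
    (Lp.memLp ξ).mono_measure (Measure.restrict_mono_set volume Ioc_subset_Icc_self)
  have h := (hasSum_sq_fourierCoeffOn hab hL2).mul_left (b - a)
  rw [intervalIntegral.integral_of_le hab.le, ← integral_Icc_eq_integral_Ioc, smul_eq_mul,
    ← mul_assoc, mul_inv_cancel₀ hba.ne', one_mul, ← norm_sq_eq_integral] at h
  have e : (fun n : ℤ ↦ ‖⟪expVector a b n, ξ⟫_ℂ‖ ^ 2)
      = fun n : ℤ ↦ (b - a) * ‖fourierCoeffOn hab (ξ : ℝ → ℂ) n‖ ^ 2 := by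
    funext n
    rw [inner_expVector_intCast_eq_fourierCoeffOn hab, norm_mul, mul_pow, Complex.norm_real,
      Real.norm_eq_abs, abs_of_nonneg (Real.sqrt_nonneg _), Real.sq_sqrt hba.le]
  rw [e]
  exact h

/-! ## Orthonormality on a general interval of length `L` -/

/-- **`(ξ_n)_{n∈ℤ}` is orthonormal in `L²([a, b])`** for any interval (`∫_a^b L⁻¹e^{2πi(k−n)x/L} dx
= δ_{nk}`, `L = b − a`); the symmetric case `[−L/2, L/2]` is `orthonormal_expVector_int`.
[cite: ConnesConsani2021, Lemma 6.4 §6.5 p. 25 (proof)] -/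
theorem orthonormal_expVector_intCast (hab : a < b) :
    Orthonormal ℂ (fun n : ℤ ↦ expVector a b n) := by
  have hba : 0 < b - a := sub_pos.2 hab
  rw [orthonormal_iff_ite]
  intro n k
  split_ifs with h
  · subst h
    rw [inner_self_eq_norm_sq_to_K, norm_expVector hab]
    simp
  · rw [inner_expVector_expVector hab, integral_Icc_eq_integral_Ioc,
      ← intervalIntegral.integral_of_le hab.le]
    set c : ℂ := ((2 * π * ((k : ℝ) - n) / (b - a) : ℝ) : ℂ) * I with hc
    have hkn : (k : ℝ) - n ≠ 0 := sub_ne_zero.2 (by exact_mod_cast (Ne.symm h))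
    have hc0 : c ≠ 0 :=
      mul_ne_zero (Complex.ofReal_ne_zero.2 (div_ne_zero
        (mul_ne_zero (mul_ne_zero two_ne_zero Real.pi_ne_zero) hkn) hba.ne')) Complex.I_ne_zero
    have hint : ∫ x in a..b, expKernel a b ((k : ℝ) - n) x
        = (((b - a)⁻¹ : ℝ) : ℂ) * ∫ x in a..b, Complex.exp (c * x) := by
      rw [← intervalIntegral.integral_const_mul]
      refine intervalIntegral.integral_congr fun x _ ↦ ?_
      simp only [expKernel, hc]
      congr 2
      push_cast
      ring
    have hba' : (b : ℂ) - a ≠ 0 := by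
      rw [← Complex.ofReal_sub]
      exact Complex.ofReal_ne_zero.2 hba.ne'
    have hper : Complex.exp (c * b) = Complex.exp (c * a) := by
      have e : c * b = c * a + ((k - n : ℤ) : ℂ) * (2 * π * I) := by
        rw [hc]
        push_cast
        field_simp
        ring
      rw [e, Complex.exp_add, Complex.exp_int_mul_two_pi_mul_I, mul_one]
    rw [hint, integral_exp_mul_complex hc0, hper, sub_self, zero_div, mul_zero]

/-! ## Completeness: "the vectors `ξ_n` form an orthonormal basis of `𝓗`" -/

/-- **Completeness of `(ξ_n)_{n∈ℤ}`**: a vector of `𝓗 = L²(I)` orthogonal to every `ξ_n` is zero.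
[cite: ConnesConsani2021, Lemma 6.4 §6.5 p. 25 (proof)] -/
theorem eq_zero_of_forall_inner_expVector (hab : a < b) {ξ : Lp ℂ 2 (volume.restrict (Icc a b))}
    (h : ∀ n : ℤ, ⟪expVector a b n, ξ⟫_ℂ = 0) : ξ = 0 := by
  have hP := hasSum_sq_norm_inner_expVector hab ξ
  simp only [h, norm_zero, zero_pow two_ne_zero] at hP
  have h0 : ‖ξ‖ ^ 2 = 0 := hP.unique hasSum_zero
  exact norm_eq_zero.1 ((pow_eq_zero_iff two_ne_zero).1 h0)

/-- `(span{ξ_n : n ∈ ℤ})^⊥ = 0` in `𝓗 = L²(I)`. [cite: ConnesConsani2021, Lemma 6.4 §6.5 p. 25 (proof)] -/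
theorem orthogonal_span_expVector_eq_bot (hab : a < b) :
    (span ℂ (Set.range fun n : ℤ ↦ expVector a b n))ᗮ = ⊥ := by
  rw [Submodule.eq_bot_iff]
  intro ξ hξ
  exact eq_zero_of_forall_inner_expVector hab fun n ↦
    (Submodule.mem_orthogonal _ ξ).1 hξ _ (subset_span ⟨n, rfl⟩)

/-- **"the vectors `ξ_n` form an orthonormal basis of `𝓗`"** (proof of Lemma 6.4, p. 25):
`(ξ_n)_{n∈ℤ}` is (the family underlying) a Hilbert basis of `𝓗 = L²([a, b])`.
[cite: ConnesConsani2021, Lemma 6.4 §6.5 p. 25 (proof)] -/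
theorem exists_hilbertBasis_expVector (hab : a < b) :
    ∃ B : HilbertBasis ℤ ℂ (Lp ℂ 2 (volume.restrict (Icc a b))),
      ⇑B = fun n : ℤ ↦ expVector a b n :=
  ⟨HilbertBasis.mkOfOrthogonalEqBot (orthonormal_expVector_intCast hab)
      (orthogonal_span_expVector_eq_bot hab),
    HilbertBasis.coe_mkOfOrthogonalEqBot _ _⟩

/-- The closed linear span of `(ξ_n)_{n∈ℤ}` is all of `𝓗 = L²(I)`.
[cite: ConnesConsani2021, Lemma 6.4 §6.5 p. 25 (proof)] -/
theorem topologicalClosure_span_expVector (hab : a < b) :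
    (span ℂ (Set.range fun n : ℤ ↦ expVector a b n)).topologicalClosure = ⊤ := by
  obtain ⟨B, hB⟩ := exists_hilbertBasis_expVector hab
  rw [← hB]
  exact B.dense_span

/-! ## `Σ_{n∈ℤ} e_n = 1` -/

/-- **`Σ_{n∈ℤ} e_n = 1`** on `𝓗 = L²(I)` (the identity behind "`Tψ = λ Σ e_n ψ = λψ`", proof of
Lemma 6.4, and behind (opT)): `Σ_{n∈ℤ} e_n ψ = ψ`, unconditionally convergent in norm.
[cite: ConnesConsani2021, Lemma 6.4 §6.5 p. 25 (proof)] -/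
theorem hasSum_expProj (hab : a < b) (ψ : Lp ℂ 2 (volume.restrict (Icc a b))) :
    HasSum (fun n : ℤ ↦ expProj a b n ψ) ψ := by
  obtain ⟨B, hB⟩ := exists_hilbertBasis_expVector hab
  have h := B.hasSum_repr ψ
  simp_rw [B.repr_apply_apply, hB] at h
  simp_rw [expProj_apply]
  exact h

/-- `Σ_{n∈ℤ} e_n = 1`, weak form / Parseval: `Σ_{n∈ℤ} ⟨η|e_n ξ⟩ = Σ_n ⟨η|ξ_n⟩⟨ξ_n|ξ⟩ = ⟨η|ξ⟩`.
[cite: ConnesConsani2021, Lemma 6.4 §6.5 p. 25 (proof)] -/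
theorem hasSum_inner_expProj (hab : a < b) (ξ η : Lp ℂ 2 (volume.restrict (Icc a b))) :
    HasSum (fun n : ℤ ↦ ⟪η, expProj a b n ξ⟫_ℂ) ⟪η, ξ⟫_ℂ := by
  obtain ⟨B, hB⟩ := exists_hilbertBasis_expVector hab
  have h := B.hasSum_inner_mul_inner η ξ
  simp_rw [hB] at h
  simp_rw [inner_expProj]
  exact h

/-! ## The last sentence of the proof of Lemma 6.4, literal form -/

/-- `e_α ψ = 0` when `ψ ⊥ ξ_α`. [cite: ConnesConsani2021, §6.4 p. 24] -/
theorem expProj_apply_eq_zero {α : ℝ} {ψ : Lp ℂ 2 (volume.restrict (Icc a b))}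
    (h : ⟪expVector a b α, ψ⟫_ℂ = 0) : expProj a b α ψ = 0 := by
  rw [expProj_apply, h, zero_smul]

/-- `Σ_{n=1}^{m} g(n) = Σ_{i<m} g(i+1)`. [folklore] -/
private theorem sum_Icc_one_eq_sum_range {M : Type*} [AddCommMonoid M] (g : ℕ → M) (m : ℕ) :
    ∑ n ∈ Finset.Icc 1 m, g n = ∑ i ∈ Finset.range m, g (i + 1) := by
  induction m with
  | zero => simp
  | succ k ih => rw [Finset.sum_Icc_succ_top (Nat.le_add_left 1 k), ih, Finset.sum_range_succ]

/-- **"all the terms in the above sum for `|n| > m` vanish"** (Lemma 6.3) made precise by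
completeness: if `ψ ⊥ ξ_n` and `ψ ⊥ ξ_{−n}` for every `n > m`, then
`(e_0 + Σ_{n=1}^{m} (e_n + e_{−n})) ψ = Σ_{n∈ℤ} e_n ψ = ψ`.
[cite: ConnesConsani2021, Lemma 6.4 §6.5 p. 25 (proof)] -/
theorem expProj_partial_sum_eq_self (hab : a < b) (m : ℕ)
    {ψ : Lp ℂ 2 (volume.restrict (Icc a b))}
    (hpos : ∀ n : ℕ, m < n → ⟪expVector a b n, ψ⟫_ℂ = 0)
    (hneg : ∀ n : ℕ, m < n → ⟪expVector a b (-(n : ℝ)), ψ⟫_ℂ = 0) :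
    expProj a b 0 ψ + ∑ n ∈ Finset.Icc 1 m, (expProj a b n ψ + expProj a b (-(n : ℝ)) ψ) = ψ := by
  set f : ℤ → Lp ℂ 2 (volume.restrict (Icc a b)) := fun n ↦ expProj a b n ψ with hf
  have h1 : HasSum f ψ := hasSum_expProj hab ψ
  have h2 := h1.nat_add_neg
  have hzero : ∀ n ∉ Finset.range (m + 1), f n + f (-(n : ℤ)) = 0 := by
    intro n hn
    rw [Finset.mem_range, not_lt] at hn
    have hmn : m < n := by omega
    simp only [hf, Int.cast_neg, Int.cast_natCast]
    rw [expProj_apply_eq_zero (hpos n hmn), expProj_apply_eq_zero (hneg n hmn), add_zero]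
  have h3 : ∑ n ∈ Finset.range (m + 1), (f n + f (-(n : ℤ))) = ψ + f 0 :=
    (hasSum_sum_of_ne_finset_zero (f := fun n : ℕ ↦ f n + f (-(n : ℤ))) hzero).unique h2
  rw [Finset.sum_range_succ'] at h3
  simp only [hf, Int.cast_neg, Int.cast_natCast, Nat.cast_zero, Int.cast_zero, neg_zero,
    ← add_assoc] at h3
  have h4 := add_right_cancel h3
  rw [sum_Icc_one_eq_sum_range, add_comm]
  exact h4

/-- **The last sentence of the proof of Lemma 6.4, in its literal (infinite) form**: "The
orthogonality of `ψ` to all the vectors `ξ_{α_n}` shows using (opT) that `Tψ = λ Σ e_n ψ = λψ`,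
since the vectors `ξ_n` form an orthonormal basis of `𝓗`" — with CC's conventions
`α_{−n} = −α_n` and "`α_n = n` for `n > m`": if `⟨ξ_{α_n}|ψ⟩ = ⟨ξ_{−α_n}|ψ⟩ = 0` for all `n ≥ 1`,
then `Tψ = λψ`.  (The Paley–Wiener construction of `ψ` and `h(α_n) = 0` are not typed.)
[cite: ConnesConsani2021, Lemma 6.4 §6.5 p. 25 (proof)] -/
theorem opT_apply_of_orthogonal_of_convention (hab : a < b) (lam : ℝ) (α d : ℕ → ℝ) (m : ℕ)
    {ψ : Lp ℂ 2 (volume.restrict (Icc a b))}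
    (hα : ∀ n : ℕ, 1 ≤ n → ⟪expVector a b (α n), ψ⟫_ℂ = 0)
    (hα' : ∀ n : ℕ, 1 ≤ n → ⟪expVector a b (-(α n)), ψ⟫_ℂ = 0)
    (hconv : ∀ n : ℕ, m < n → α n = n) :
    opT a b lam α d m ψ = (lam : ℂ) • ψ := by
  refine opT_apply_of_orthogonal lam α d m (fun n hn ↦ hα n (Finset.mem_Icc.1 hn).1)
    (fun n hn ↦ hα' n (Finset.mem_Icc.1 hn).1) (expProj_partial_sum_eq_self hab m ?_ ?_)
  · intro n hn
    rw [← hconv n hn]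
    exact hα n (by omega)
  · intro n hn
    rw [← hconv n hn]
    exact hα' n (by omega)

/-! ## The Parseval step of the proof of Lemma 6.6 -/

/-- **Proof of Lemma 6.6, Parseval step** on CC's interval `[−L/2, L/2]` (`L = log 2`): with
`P(n) = Σ_{|j|<n} e_j` "the orthogonal projection on the linear span of the vectors `ξ_j` for
`|j| < n`" and "`(ξ_α)_k = sin(π(α−k))/(π(α−k))`",
`‖ξ_α − P(n)ξ_α‖² = Σ_{|k| ≥ n} (sin(π(α−k))/(π(α−k)))²` (`Real.sinc x = sin x/x`, `sinc 0 = 1`).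
The evaluation of the two tails through `(log Γ)^{(2)}` (display (majorred)) is not typed.
[cite: ConnesConsani2021, Lemma 6.6 §6.6 p. 25 (proof)] -/
theorem hasSum_sinc_sq_norm_sub_proj {L : ℝ} (hL : 0 < L) (n : ℕ) (α : ℝ) :
    HasSum (fun k : {k : ℤ // (n : ℤ) ≤ |k|} ↦ Real.sinc (π * (α - ((k : ℤ) : ℝ))) ^ 2)
      (‖expVector (-(L / 2)) (L / 2) α - ∑ j ∈ Finset.Ioo (-(n : ℤ)) n,
          expProj (-(L / 2)) (L / 2) j (expVector (-(L / 2)) (L / 2) α)‖ ^ 2) := by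
  have hab : -(L / 2) < L / 2 := by linarith
  set ξ := expVector (-(L / 2)) (L / 2) α with hξ
  set S := Finset.Ioo (-(n : ℤ)) n with hS
  set ρ := ξ - ∑ j ∈ S, expProj (-(L / 2)) (L / 2) j ξ with hρ
  have hmem : ∀ k : ℤ, k ∈ S ↔ |k| < n := fun k ↦ by rw [hS, Finset.mem_Ioo, abs_lt]
  have hon := orthonormal_iff_ite.1 (orthonormal_expVector_int hL)
  -- the coefficients of `ρ = ξ_α − P(n)ξ_α`
  have hcoef : ∀ k : ℤ, ⟪expVector (-(L / 2)) (L / 2) k, ρ⟫_ℂ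
      = if k ∈ S then 0 else ⟪expVector (-(L / 2)) (L / 2) k, ξ⟫_ℂ := by
    intro k
    rw [hρ, inner_sub_right, inner_sum]
    have hterm : ∀ j ∈ S, ⟪expVector (-(L / 2)) (L / 2) (k : ℝ),
        expProj (-(L / 2)) (L / 2) (j : ℝ) ξ⟫_ℂ
          = if k = j then ⟪expVector (-(L / 2)) (L / 2) (k : ℝ), ξ⟫_ℂ else 0 := by
      intro j _
      rw [inner_expProj, hon k j]
      split_ifs with hkj
      · subst hkj
        simp
      · simp
    rw [Finset.sum_congr rfl hterm, Finset.sum_ite_eq]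
    split_ifs <;> simp
  -- Parseval for `ρ`
  have hP := hasSum_sq_norm_inner_expVector hab ρ
  set F : ℤ → ℝ := fun k ↦ if (n : ℤ) ≤ |k| then Real.sinc (π * (α - k)) ^ 2 else 0 with hF
  have hfun : (fun k : ℤ ↦ ‖⟪expVector (-(L / 2)) (L / 2) k, ρ⟫_ℂ‖ ^ 2) = F := by
    funext k
    simp only [hF]
    rw [hcoef k]
    by_cases hk : (n : ℤ) ≤ |k|
    · have hkS : k ∉ S := fun h ↦ (not_lt.2 hk) ((hmem k).1 h)
      rw [if_neg hkS, if_pos hk, hξ, inner_expVector_expVector_symm hL, Complex.norm_real,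
        Real.norm_eq_abs, sq_abs]
    · have hkS : k ∈ S := (hmem k).2 (not_le.1 hk)
      rw [if_pos hkS, if_neg hk, norm_zero, zero_pow two_ne_zero]
  rw [hfun] at hP
  have hout : ∀ x ∉ Set.range (Subtype.val : {k : ℤ // (n : ℤ) ≤ |k|} → ℤ), F x = 0 := by
    intro x hx
    have hx' : ¬ (n : ℤ) ≤ |x| := fun h ↦ hx ⟨⟨x, h⟩, rfl⟩
    simp only [hF]
    rw [if_neg hx']
  have h := (Subtype.val_injective.hasSum_iff hout).2 hP
  have e : (fun k : {k : ℤ // (n : ℤ) ≤ |k|} ↦ Real.sinc (π * (α - ((k : ℤ) : ℝ))) ^ 2)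
      = F ∘ Subtype.val := by
    funext k
    simp only [Function.comp_apply, hF]
    rw [if_pos k.2]
  rw [e]
  exact h

end Literature.NumberTheory.ConnesConsani2021

end
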